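import Summits.AtomisticToContinuum.Crystallization.Theorems.PalmUnimodularRigidityMinimiserShellsResidualDefs

/-!
# The residual predicate `ShellGap θ` of crux `MinimiserShells` (stmt-AtomisticToContinuum-9225) is MONOTONE in `θ`

Route `PalmUnimodularRigidity`, line `equilibrium-in-law-surgery`, lead `…-c6-0`.  `Residual.ShellGap θ` is the `θ`-loosened
`1/3`-hard-core periodic shell gap (`ResidualDefs.lean`, p125876); the crux is pinned between `ShellGap 0` (the line's open
residual S7⁗) and every `ShellGap θ`, `θ ∈ (0, 1/10]` (`Residual.minimiserShells_sandwich`).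

This file proves that on `[0, 1/10]` the loosened good-shell predicate is monotone in the loosening parameter
(`looseGoodShell_mono`: loosening the tolerance to `a/100 + θ₂` and shrinking the radius to `(5/4 − θ₂)·a` keeps a
`θ₁`-loosely-good shell good — the matched atoms have norm `≤ a + a/100 + θ₁ ≤ (5/4 − θ₂)·a` because `a ≥ 9/10`, so the shell set
does not change), hence the loosely-bad counts are antitone (`looseBadMotifCount_anti`) and **`ShellGap` is monotone**
(`shellGap_mono : ShellGap θ₁ → ShellGap θ₂` for `0 ≤ θ₁ ≤ θ₂ ≤ 1/10`).  Consequently `{θ ∈ [0, 1/10] | ShellGap θ}` is an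
up-set containing `(0, 1/10]` if the crux holds (`shellGap_of_minimiserShells`) and equal to all of `[0, 1/10]` iff `ShellGap 0`
(`shellGap_of_shellGap_zero`); the crux sits exactly at the endpoint: `ShellGap 0 → MinimiserShells → ⋀_{θ>0} ShellGap θ`.
-/

noncomputable section

open MeasureTheory
open scoped ENNReal BigOperators Classical

namespace Summit.AtomisticToContinuum.Crystallization.Theorems.PalmUnimodularRigidityMinimiserShells.Residual

open Literature.MathematicalPhysics.StatisticalMechanics (lennardJones PeriodicConfiguration)
open Summit.AtomisticToContinuum.Crystallization.Theses.PalmUnimodularRigidity (MinimiserShells)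
open Literature.Geometry.DiscreteGeometry (ShellCloseTo EtaMatched fccKissingPattern hcpKissingPattern
  norm_eq_one_of_mem_fccKissingPattern norm_eq_one_of_mem_hcpKissingPattern)

/-- A shell `η`-close to the `a`-scaled copy (`a ≥ 0`) of a pattern of unit vectors lies in the closed ball of radius `a + η`. -/
theorem norm_le_of_shellCloseTo {η a : ℝ} (ha : 0 ≤ a) {T P : Finset (EuclideanSpace ℝ (Fin 3))}
    (hP : ∀ v ∈ P, ‖v‖ = 1)
    (h : ShellCloseTo η T (Finset.image (fun v : EuclideanSpace ℝ (Fin 3) => a • v) P)) :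
    ∀ w ∈ T, ‖w‖ ≤ a + η := by
  intro w hw
  obtain ⟨A, e, he⟩ := h
  have hmem : ((e ⟨w, hw⟩ : ↥(Finset.image A (Finset.image (fun v => a • v) P))) : EuclideanSpace ℝ (Fin 3)) ∈
      Finset.image A (Finset.image (fun v : EuclideanSpace ℝ (Fin 3) => a • v) P) := (e ⟨w, hw⟩).2
  obtain ⟨u, hu, hu'⟩ := Finset.mem_image.1 hmem
  obtain ⟨v, hv, rfl⟩ := Finset.mem_image.1 hu
  have hnorm : ‖((e ⟨w, hw⟩ : ↥(Finset.image A (Finset.image (fun v => a • v) P))) : EuclideanSpace ℝ (Fin 3))‖ = a := by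
    rw [← hu', A.norm_map, norm_smul, hP v hv, mul_one, Real.norm_of_nonneg ha]
  have hd := he ⟨w, hw⟩
  calc ‖w‖ = ‖(w - (e ⟨w, hw⟩ : EuclideanSpace ℝ (Fin 3))) + (e ⟨w, hw⟩ : EuclideanSpace ℝ (Fin 3))‖ := by
        rw [sub_add_cancel]
    _ ≤ ‖w - (e ⟨w, hw⟩ : EuclideanSpace ℝ (Fin 3))‖ + ‖(e ⟨w, hw⟩ : EuclideanSpace ℝ (Fin 3))‖ := norm_add_le _ _
    _ ≤ η + a := by rw [← dist_eq_norm, hnorm]; exact add_le_add hd le_rfl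
    _ = a + η := add_comm _ _

/-- `ShellCloseTo` is monotone in the tolerance. -/
theorem shellCloseTo_mono {η η' : ℝ} (hη : η ≤ η') {T P : Finset (EuclideanSpace ℝ (Fin 3))}
    (h : ShellCloseTo η T P) : ShellCloseTo η' T P := by
  obtain ⟨A, hA⟩ := h
  exact ⟨A, hA.mono hη⟩

/-- **The loosened good-shell predicate is monotone in `θ` on `[0, 1/10]`.**  If the shell of `μ` passes the test with
tolerance `a/100 + θ₁` inside radius `(5/4 − θ₁)·a`, it passes with tolerance `a/100 + θ₂` inside radius `(5/4 − θ₂)·a` for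
`θ₁ ≤ θ₂ ≤ 1/10`: the twelve matched atoms have norm `≤ a + a/100 + θ₁ ≤ (5/4 − θ₂)·a` (as `a ≥ 9/10`), so the smaller ball
contains the same atoms, and the matching tolerance only grew. -/
theorem looseGoodShell_mono {θ₁ θ₂ : ℝ} (h₁ : 0 ≤ θ₁) (h₁₂ : θ₁ ≤ θ₂) (h₂ : θ₂ ≤ 1 / 10)
    {μ : Measure (EuclideanSpace ℝ (Fin 3))} (h : LooseGoodShell θ₁ μ) : LooseGoodShell θ₂ μ := by
  obtain ⟨a, ha₁, ha₂, T, hT, hclose⟩ := h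
  have ha0 : 0 ≤ a := by linarith
  -- every atom of the shell set has norm `≤ a + a/100 + θ₁`
  have hnormT : ∀ w ∈ T, ‖w‖ ≤ a + (a / 100 + θ₁) := by
    rcases hclose with hc | hc
    · exact norm_le_of_shellCloseTo ha0 (fun v hv => norm_eq_one_of_mem_fccKissingPattern hv) hc
    · exact norm_le_of_shellCloseTo ha0 (fun v hv => norm_eq_one_of_mem_hcpKissingPattern hv) hc
  have hrad : a + (a / 100 + θ₁) ≤ (5 / 4 - θ₂) * a := by nlinarith
  refine ⟨a, ha₁, ha₂, T, ?_, ?_⟩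
  · ext w
    simp only [Set.mem_setOf_eq]
    constructor
    · intro hw
      have hw' : w ∈ (↑T : Set (EuclideanSpace ℝ (Fin 3))) := hw
      rw [hT] at hw'
      exact ⟨hw'.1, hw'.2.1, (hnormT w hw).trans hrad⟩
    · rintro ⟨hμ, hw0, hwn⟩
      have : w ∈ (↑T : Set (EuclideanSpace ℝ (Fin 3))) := by
        rw [hT]
        refine ⟨hμ, hw0, hwn.trans ?_⟩
        nlinarith
      exact this
  · have hη : a / 100 + θ₁ ≤ a / 100 + θ₂ := by linarith
    rcases hclose with hc | hc
    · exact Or.inl (shellCloseTo_mono hη hc)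
    · exact Or.inr (shellCloseTo_mono hη hc)

/-- The `θ`-loosely-bad motif counts are ANTITONE in `θ` on `[0, 1/10]`. -/
theorem looseBadMotifCount_anti {θ₁ θ₂ : ℝ} (h₁ : 0 ≤ θ₁) (h₁₂ : θ₁ ≤ θ₂) (h₂ : θ₂ ≤ 1 / 10)
    (Q : PeriodicConfiguration 3) : looseBadMotifCount θ₂ Q ≤ looseBadMotifCount θ₁ Q := by
  unfold looseBadMotifCount
  rw [Nat.card_eq_fintype_card, Nat.card_eq_fintype_card]
  exact Fintype.card_subtype_mono _ _ fun x hx hgood => hx (looseGoodShell_mono h₁ h₁₂ h₂ hgood)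

/-- **`ShellGap` is monotone in `θ` on `[0, 1/10]`**: pricing the `θ₁`-loosely-bad sites prices the (fewer) `θ₂`-loosely-bad
ones, `θ₁ ≤ θ₂`. -/
theorem shellGap_mono :
    ∀ θ₁ θ₂ : ℝ, 0 ≤ θ₁ → θ₁ ≤ θ₂ → θ₂ ≤ 1 / 10 → ShellGap θ₁ → ShellGap θ₂ := by
  intro θ₁ θ₂ h₁ h₁₂ h₂ hgap t ht
  obtain ⟨κ, hκ, hQ⟩ := hgap t ht
  refine ⟨κ, hκ, fun Q hsep hbad => hQ Q hsep (hbad.trans ?_)⟩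
  exact_mod_cast looseBadMotifCount_anti h₁ h₁₂ h₂ Q

/-- `ShellGap 0` gives `ShellGap θ` for every `θ ∈ [0, 1/10]`. -/
theorem shellGap_of_shellGap_zero (h : ShellGap 0) {θ : ℝ} (hθ : 0 ≤ θ) (hθ' : θ ≤ 1 / 10) : ShellGap θ :=
  shellGap_mono 0 θ le_rfl hθ hθ' h

/-- **Position of the crux on the `θ`-axis.**  `{θ ∈ [0, 1/10] | ShellGap θ}` is an up-set (`shellGap_mono`); the crux
`MinimiserShells` forces it to contain `(0, 1/10]` and is forced by its containing `0`:
`ShellGap 0 → MinimiserShells → ∀ θ ∈ (0, 1/10], ShellGap θ`, and `ShellGap 0 ↔ ∀ θ ∈ [0, 1/10], ShellGap θ`. -/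
theorem shellGap_zero_iff_forall : ShellGap 0 ↔ ∀ θ : ℝ, 0 ≤ θ → θ ≤ 1 / 10 → ShellGap θ :=
  ⟨fun h _ hθ hθ' => shellGap_of_shellGap_zero h hθ hθ', fun h => h 0 le_rfl (by norm_num)⟩

end Summit.AtomisticToContinuum.Crystallization.Theorems.PalmUnimodularRigidityMinimiserShells.Residual

end
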